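import Summits.QuantumFields.BalabanUV.Beta.GAN24.ContactLambdaCellFactorised
import Summits.QuantumFields.BalabanUV.Beta.GAN24.ContactBorderKernelCells

/-!
# `GAN24.ContactBorderCommutator` — CT-ROUTE, BORNSEC-PLAN v1 §0 (last paragraph, the V half) ∕ §A (V-C) socket re-reading (row owner gan24-p1-g20): the V∕H TWIN of
# `ContactLambdaCommutator` ∕ `ContactLambdaCellFactorised` — the PACKED first-order partner `linSymAt` of the border cells through the `q¹`-pairing, the one-gauge border cells
# FACTORISED over the packed multiplier site (multiplier leg × two-site commutator of the rooted block averaging with the gauge function), and the V-born kernel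
# sockets `ContactBorderKernelCells.contact_border_fm∕mf_eq_cells` re-read in that form under THEIR hypotheses

HONEST FRAMING (cell charter, verbatim): «discharging `BetaPertH` makes Bałaban's UV stability UNCONDITIONAL — a real constructive-QFT result;
it is NOT the continuum limit and NOT the Clay problem.»  DERIVED cell leaf (pub-balaban, G-an2-4 formalisation swarm → CRUX TEAM (2), seat
`b2b-balaban-gan24-formalise-leaf-02`, gen 48): [folklore] bookkeeping over this lineage's `ContactLambdaCommutator` (the `q¹`-pairing) ∕ `ContactLambdaCellFactorised`
(the dominated-exchange script), an1's `AveragingWardRootedStencils.linSymAt_inl_inr` and this lineage's `ContactBorderPartner` ∕ `ContactBorderKernelCells` BY NAME; NO cited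
fact, NO `def`, NO `def … : Prop`, NO sorry, NO wall binder; legs ∕ gauge functions ARBITRARY under the displayed letters.  Discharges NO letter of (CONV-C): the V half of
`BORNSEC-PLAN-v1.md` §0 («the two field slots of `H_{μy}` … get covariance cells … partner `linSymAt` … with the same Δλ»; M-V: the multiplier leg IS the next Hessian) reads the
border cells as (multiplier leg) × (commutator of the fine leg); the letters (C3)(C4), the sums (C5) and the assembly (C6) are NOT here; NEVER «G-an2-4 closed»; NOT hS0,
NOT D1, NOT `BetaPertH`, NOT continuum, NOT Clay.  «not in print; our bookkeeping».
HONEST DEPENDENCY (cell records, verbatim): «continuum YM on T⁴ ⇐ BetaPertH ∧ nine spine estimates (0/9 proved); BetaPertH ⇐ (D1) ∧ (D4) ∧ CAP+tail;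
G-an2-4 gates asym, D1 and NE2/3/4.»
ABSOLUTE RULE (cell charter, verbatim): «No internally-minted statement may enter as a cited fact. Every hypothesis is either kernel-proved in this
package or a verbatim quotation of a PUBLISHED theorem with page reference. The manuscript(s) under audit are NOT citable for their own disputed steps —
they are the thing under adjudication; programme-internal (2001/route/tribunal) claims are never citable.»

## What is proved (box root `ρ = toSite r`; generic `d`; `q = linSymAt ρ L`, `q(u,z)(inl κ)(inr μ) = [off L z = 0]·q¹,ρ_{(μ, blk L z)}(κ, u)`)
* §0 docking letters `reslot_smul`, `push₃_reslot_smul` (the V lineage's channels carry `cVH • vhSAt ρ`; the sockets take the bare table — one `rw`).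
* §1 **`tsum_sum_mul_weight_mul_linSymAt`**: `Σ'_u Σ_κ T κ u·(w κ u·q(u,z)(inl κ)(inr μ)) = [off L z = 0]·(L^{d+1})⁻¹·linAvgAt ρ (w•T) L μ (blk L z)` (EVERY `T`, `w`); the two
  weights of the border cells: **`tsum_sum_mul_tipWeight_mul_linSymAt`** (`w = ψ(u + e_κ) − c`: `= [off z = 0]·(L^{d+1})⁻¹·(linAvgAt ρ (ψ⁺•T) − c·linAvgAt ρ T)`, `(ψ⁺•T) κ u =
  ψ(u+e_κ)·T κ u`) and **`tsum_sum_mul_rootWeight_mul_linSymAt`** (`w = c − ψ x`: `= [off z = 0]·(L^{d+1})⁻¹·(c·linAvgAt ρ T − linAvgAt ρ (ψ•T))`) — two-site commutators of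
  the rooted block averaging with the gauge function (the far end `c = ψ(z + ρ + L·e_μ)` ∕ the root `c = ψ(z + ρ)` is constant in the fine variable).
* §2 **`tsum_sum_mul_tsum_sum_mul_comm`**: the dominated exchange for the border cells whose fine leg sits OUTSIDE the packed sum (fine leg with summable slices,
  multiplier leg bounded, kernel bounded on the support; product summability by road S3's brick and the packed near-set `L • (near-set)`); the two generic cells of
  `ContactOneGaugeCellBorder` exchanged and factorised: **`tsum_sum_leg_mul_tsum_sum_mul_rootWeight`** (`cellVidx_eq`'s shape), **`tsum_sum_leg_mul_tsum_sum_mul_tipWeight`**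
  (`cellVflu_eq`'s shape).
* §3 the SOCKETS: **`contact_border_fm_eq_factorised`** and **`contact_border_mf_eq_factorised`** = `ContactBorderKernelCells.contact_border_fm∕mf_eq_cells` (p287007) with every
  cell written as (multiplier leg at the packed site) × (two-site commutator of the fine leg), under EXACTLY their hypotheses.
NOT HERE: any estimate; the route's instance (`BornBorderLineage` legs — one `exact` per socket).
Provenance: seat b2b-balaban-gan24-formalise-leaf-02 gen 48 (prover-…-leaf-02-g48-0), 2026-08-21; over the files named above BY NAME.
-/

open Finset
open scoped BigOperators
open Literature.MathematicalPhysics.QuantumFieldTheory.Balaban1983to89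
open Literature.MathematicalPhysics.QuantumFieldTheory.Balaban1983to89.Beta
open AffineAveraging AveragingContours AveragingHessianKernels AveragingContoursRooted AveragingHessianKernelsRooted
open B12Sec2to5 (l1 l1_nonneg)
open ExpKernelCalculus (l1_sub_triangle l1_sub_symm)
open StepJetData (l1_unitVec)
open AveragingWardStencils (b6UnitVec_eq)
open InterLevelTransport (SLam)
open ExpKernelCalculus (MKer)
open OneStepResolventKernel (Fib)
open Summit.QuantumFields.BalabanUV.Beta.AveragingWardRootedStencils (linSymAt linSymAt_inl_inr)
open Summit.QuantumFields.BalabanUV.Beta.LinearGaugeVH (nearBox mem_nearBox summable_of_finsupp)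
open Summit.QuantumFields.BalabanUV.Beta.GAN24.ContactBorderPartner (exists_finset_near_card off_eq_zero_and_near_of_linSymAt_ne_zero
  abs_linSymAt_inl_inr_le l1_farEnd_sub_le_of_mem)
open Summit.QuantumFields.BalabanUV.Beta.GAN24.ContactOneGaugeCellLambda (l1_root_sub_le_of_mem)
open Summit.QuantumFields.BalabanUV.Beta.GAN24.TaylorLamBracket (summable_uncurry_of_fibre_bound)
open Summit.QuantumFields.BalabanUV.Beta.GAN24.Push3 (push₃ push₃_smul)
open Summit.QuantumFields.BalabanUV.Beta.GAN24.SrecLinearPartEq (reslot)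
open Summit.QuantumFields.BalabanUV.Beta.GAN24.ContactBorderKernelCells (contact_border_fm_eq_cells contact_border_mf_eq_cells)
open Summit.QuantumFields.BalabanUV.Beta.GAN24.ContactLambdaCommutator (tsum_sum_linKerAt_mul abs_sub_le_mul_l1_of_dz prox_of_near)

noncomputable section

namespace Summit.QuantumFields.BalabanUV.Beta.GAN24.ContactBorderCommutator

variable {d : ℕ}

/-! ## §0 Docking letters: re-slotting and the three-leg push are linear in the table (the V lineage carries the SCALED table `cVH • vhSAt ρ`) -/

section Docking

/-- [folklore] Re-slotting commutes with scalars (pointwise; no hypothesis) — the V-lineage channels of `BornBorderLineage.unitStepMap_v_eq_two_push₃` carry `cVH • vhSAt ρ`,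
the sockets below the bare `vhSAt ρ`. -/
theorem reslot_smul (σ τ : Fin (d + 1) → Fib d) (c : ℝ) (S : Fin (d + 1) → (Fin (d + 1) → ℤ) → MKer (d + 1) (Fib d)) :
    reslot σ τ (fun κ u => c • S κ u) = fun κ u => c • reslot σ τ S κ u := by
  funext κ u x z a b
  rcases a with κ₁ | μ <;> rcases b with κ₂ | ν <;> simp [reslot]

/-- [folklore] Hence the three-leg push of a re-slotted SCALED table is the scaled push (`Push3.push₃_smul`), for any legs. -/
theorem push₃_reslot_smul (l r w : Fin (d + 1) → (Fin (d + 1) → ℤ) → Fin (d + 1) → (Fin (d + 1) → ℤ) → ℝ) (σ τ : Fin (d + 1) → Fib d) (c : ℝ)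
    (S : Fin (d + 1) → (Fin (d + 1) → ℤ) → MKer (d + 1) (Fib d)) (κ' : Fin (d + 1)) (u' : Fin (d + 1) → ℤ) :
    push₃ l r w (reslot σ τ fun κ u => c • S κ u) κ' u' = c • push₃ l r w (reslot σ τ S) κ' u' := by
  rw [reslot_smul, push₃_smul]

end Docking

/-! ## §1 The packed partner through the `q¹`-pairing; the two weights of the border cells -/

section Pairing

variable {L : ℕ} {r : Fin (d + 1) → ℕ}

/-- [folklore] **THE PACKED PARTNER THROUGH THE `q¹`-PAIRING** (box root; every fine leg `T`, every weight `w`):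
`Σ'_u Σ_κ T κ u·(w κ u·q(u,z)(inl κ)(inr μ)) = [off L z = 0]·(L^{d+1})⁻¹·linAvgAt ρ (w•T) L μ (blk L z)`. -/
theorem tsum_sum_mul_weight_mul_linSymAt (hr : r ∈ box (d + 1) L) (T w : Form1 (d + 1) ℝ) (μ : Fin (d + 1)) (z : Fin (d + 1) → ℤ) :
    ∑' u, ∑ κ, T κ u * (w κ u * linSymAt (toSite r) L u z (Sum.inl κ) (Sum.inr μ))
      = if off L z = 0 then ((L : ℝ) ^ (d + 1))⁻¹ * linAvgAt (toSite r) (fun κ u => w κ u * T κ u) L μ (blk L z) else 0 := by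
  by_cases hz : off L z = 0
  · rw [if_pos hz, ← tsum_sum_linKerAt_mul hr (fun κ u => w κ u * T κ u) μ (blk L z)]
    refine tsum_congr fun u => Finset.sum_congr rfl fun κ _ => ?_
    rw [linSymAt_inl_inr, if_pos hz]
    ring
  · rw [if_neg hz]
    refine (tsum_congr fun u => ?_).trans tsum_zero
    exact Finset.sum_eq_zero fun κ _ => by rw [linSymAt_inl_inr, if_neg hz, mul_zero, mul_zero]

/-- [folklore] **TIP WEIGHT** (the fluctuation-slot border cell: `ψ` at the tip of the fine bond minus a constant `c` — in the cells `c = ψ(z + ρ + L·e_μ)`, the far end of the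
coarse bond): `Σ'_u Σ_κ T κ u·((ψ(u + e_κ) − c)·q(u,z)(inl κ)(inr μ)) = [off L z = 0]·(L^{d+1})⁻¹·(linAvgAt ρ (ψ⁺•T) L μ (blk L z) − c·linAvgAt ρ T L μ (blk L z))`. -/
theorem tsum_sum_mul_tipWeight_mul_linSymAt (hr : r ∈ box (d + 1) L) (T : Form1 (d + 1) ℝ) (ψ : (Fin (d + 1) → ℤ) → ℝ) (c : ℝ)
    (μ : Fin (d + 1)) (z : Fin (d + 1) → ℤ) :
    ∑' u, ∑ κ, T κ u * ((ψ (u + unitVec κ) - c) * linSymAt (toSite r) L u z (Sum.inl κ) (Sum.inr μ))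
      = if off L z = 0 then ((L : ℝ) ^ (d + 1))⁻¹ *
          (linAvgAt (toSite r) (fun κ u => ψ (u + unitVec κ) * T κ u) L μ (blk L z) - c * linAvgAt (toSite r) T L μ (blk L z)) else 0 := by
  rw [tsum_sum_mul_weight_mul_linSymAt hr T (fun κ u => ψ (u + unitVec κ) - c) μ z]
  by_cases hz : off L z = 0
  · rw [if_pos hz, if_pos hz]
    have e : (fun κ u => (ψ (u + unitVec κ) - c) * T κ u) = (fun κ u => ψ (u + unitVec κ) * T κ u) - fun κ u => c * T κ u := by
      funext κ u; simp only [Pi.sub_apply]; ring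
    have e2 : (fun κ u => c * T κ u) = TransportedContourVariables.mapForm ((c : ℝ) • AddMonoidHom.id ℝ) T := by
      funext κ u; rfl
    rw [e, linAvgAt_sub, e2, linAvgAt_mapForm]
    rfl
  · rw [if_neg hz, if_neg hz]

/-- [folklore] **ROOT WEIGHT** (the index-slot border cell: a constant `c` — in the cells `c = ψ(z + ρ)`, the root — minus `ψ` at the base of the fine bond):
`Σ'_x Σ_a T a x·((c − ψ x)·q(x,z)(inl a)(inr μ)) = [off L z = 0]·(L^{d+1})⁻¹·(c·linAvgAt ρ T L μ (blk L z) − linAvgAt ρ (ψ•T) L μ (blk L z))`. -/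
theorem tsum_sum_mul_rootWeight_mul_linSymAt (hr : r ∈ box (d + 1) L) (T : Form1 (d + 1) ℝ) (ψ : (Fin (d + 1) → ℤ) → ℝ) (c : ℝ)
    (μ : Fin (d + 1)) (z : Fin (d + 1) → ℤ) :
    ∑' x, ∑ a, T a x * ((c - ψ x) * linSymAt (toSite r) L x z (Sum.inl a) (Sum.inr μ))
      = if off L z = 0 then ((L : ℝ) ^ (d + 1))⁻¹ *
          (c * linAvgAt (toSite r) T L μ (blk L z) - linAvgAt (toSite r) (fun a x => ψ x * T a x) L μ (blk L z)) else 0 := by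
  rw [tsum_sum_mul_weight_mul_linSymAt hr T (fun _ x => c - ψ x) μ z]
  by_cases hz : off L z = 0
  · rw [if_pos hz, if_pos hz]
    have e : (fun a x => (c - ψ x) * T a x) = (fun a x => c * T a x) - fun a x => ψ x * T a x := by
      funext a x; simp only [Pi.sub_apply]; ring
    have e2 : (fun a x => c * T a x) = TransportedContourVariables.mapForm ((c : ℝ) • AddMonoidHom.id ℝ) T := by
      funext a x; rfl
    rw [e, linAvgAt_sub, e2, linAvgAt_mapForm]
    rfl
  · rw [if_neg hz, if_neg hz]

end Pairing

/-! ## §2 The dominated exchange for the border cell whose fine leg sits outside the packed sum -/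

section Exchange

variable {L : ℕ} {r : Fin (d + 1) → ℕ}

/-- [folklore] **THE DOMINATED EXCHANGE, PACKED FORM.**  For a kernel `K a x b z` supported on `{off L x = 0 ∧ Near L (blk L x) z}` and bounded there, a bounded multiplier
leg `M` and a fine leg `R` with summable slices: `Σ'_z Σ_b R b z·Σ'_x Σ_a M a x·K a x b z = Σ'_x Σ_a M a x·Σ'_z Σ_b R b z·K a x b z` (each fine site sees at most `2^{d+1}`
packed sites: product summability by `TaylorLamBracket.summable_uncurry_of_fibre_bound`, then `Summable.tsum_comm`). -/
theorem tsum_sum_mul_tsum_sum_mul_comm (hL : 1 ≤ L)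
    {K : Fin (d + 1) → (Fin (d + 1) → ℤ) → Fin (d + 1) → (Fin (d + 1) → ℤ) → ℝ} {CK : ℝ}
    (hK0 : ∀ a x b z, ¬ (off L x = 0 ∧ Near L (blk L x) z) → K a x b z = 0) (hK : ∀ a x b z, off L x = 0 ∧ Near L (blk L x) z → |K a x b z| ≤ CK)
    {M : Form1 (d + 1) ℝ} {CM : ℝ} (hM : ∀ a x, |M a x| ≤ CM)
    {R : Form1 (d + 1) ℝ} (hRs : ∀ b, Summable fun z => R b z) :
    ∑' z, ∑ b, R b z * ∑' x, ∑ a, M a x * K a x b z = ∑' x, ∑ a, M a x * ∑' z, ∑ b, R b z * K a x b z := by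
  classical
  choose S hScard hSnear _hSprox using fun z : Fin (d + 1) → ℤ => exists_finset_near_card (d := d) hL z
  have hCM : 0 ≤ CM := (abs_nonneg _).trans (hM 0 0)
  have hN0 : off L (0 : Fin (d + 1) → ℤ) = 0 ∧ Near L (blk L (0 : Fin (d + 1) → ℤ)) 0 := by
    have h1 : (1 : ℤ) ≤ L := by exact_mod_cast hL
    refine ⟨?_, fun i => ?_⟩
    · have h := RootedKernelReflection.off_zsmul L (0 : Fin (d + 1) → ℤ)
      rwa [smul_zero] at h
    · simp only [blk, Pi.zero_apply, Int.zero_ediv, mul_zero, le_refl, true_and]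
      omega
  have hCK : 0 ≤ CK := (abs_nonneg _).trans (hK 0 0 0 0 hN0)
  -- the packed sites seen by a fine site `z`: `L • (S z)`
  set P : (Fin (d + 1) → ℤ) → Finset (Fin (d + 1) → ℤ) := fun z => (S z).image fun y => (L : ℤ) • y with hP
  have hPmem : ∀ a x b z, K a x b z ≠ 0 → x ∈ P z := by
    intro a x b z h
    by_contra hx
    refine h (hK0 a x b z fun hh => hx ?_)
    rw [hP, Finset.mem_image]
    exact ⟨blk L x, hSnear z _ hh.2, (eq_smul_blk_of_off_eq_zero hL hh.1).symm⟩
  have hPcard : ∀ z, ((P z).card : ℝ) ≤ 2 ^ (d + 1) := fun z => by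
    have h1 : (P z).card ≤ (S z).card := Finset.card_image_le
    have h2 := hScard z
    exact_mod_cast h1.trans h2
  -- pointwise facts
  have hzero : ∀ a b z x, x ∉ P z → M a x * K a x b z = 0 := fun a b z x hx => by
    by_cases h : K a x b z = 0
    · rw [h, mul_zero]
    · exact absurd (hPmem a x b z h) hx
  have hbd : ∀ a b z x, |M a x * K a x b z| ≤ CM * CK := by
    intro a b z x
    by_cases h : off L x = 0 ∧ Near L (blk L x) z
    · rw [abs_mul]; exact mul_le_mul (hM a x) (hK a x b z h) (abs_nonneg _) hCM
    · rw [hK0 a x b z h, mul_zero, abs_zero]; exact mul_nonneg hCM hCK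
  have hHzero : ∀ z x, x ∉ P z → ∑ b, ∑ a, R b z * (M a x * K a x b z) = 0 := fun z x hx =>
    Finset.sum_eq_zero fun b _ => Finset.sum_eq_zero fun a _ => by rw [hzero a b z x hx, mul_zero]
  -- summability of the packed fibres
  have hsx : ∀ a b z, Summable fun x => R b z * (M a x * K a x b z) := fun a b z =>
    (summable_of_finsupp (P z) (fun x hx => hzero a b z x hx)).mul_left _
  -- product summability
  have hprod : Summable (Function.uncurry fun z x => ∑ b, ∑ a, R b z * (M a x * K a x b z)) := by
    refine summable_uncurry_of_fibre_bound (a := fun z => ∑ b, |R b z|) (K := 2 ^ (d + 1) * (((d : ℝ) + 1) * (CM * CK)))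
      (summable_sum fun b _ => (hRs b).abs) (fun z => ?_) (fun z => ?_)
    · exact summable_of_finsupp (P z) fun x hx => by
        show |∑ b, ∑ a, R b z * (M a x * K a x b z)| = 0
        rw [hHzero z x hx, abs_zero]
    · rw [tsum_eq_sum (s := P z) (fun x hx => by rw [hHzero z x hx, abs_zero])]
      have hpt : ∀ x ∈ P z, |∑ b, ∑ a, R b z * (M a x * K a x b z)| ≤ (∑ b, |R b z|) * (((d : ℝ) + 1) * (CM * CK)) := by
        intro x _
        refine (Finset.abs_sum_le_sum_abs _ _).trans ?_
        rw [Finset.sum_mul]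
        refine Finset.sum_le_sum fun b _ => (Finset.abs_sum_le_sum_abs _ _).trans ?_
        calc ∑ a, |R b z * (M a x * K a x b z)| ≤ ∑ _a : Fin (d + 1), |R b z| * (CM * CK) :=
              Finset.sum_le_sum fun a _ => by rw [abs_mul]; exact mul_le_mul_of_nonneg_left (hbd a b z x) (abs_nonneg _)
          _ = |R b z| * (((d : ℝ) + 1) * (CM * CK)) := by
              rw [Finset.sum_const, Finset.card_univ, Fintype.card_fin, nsmul_eq_mul]; push_cast; ring
      have hR0 : 0 ≤ ∑ b, |R b z| := Finset.sum_nonneg fun b _ => abs_nonneg _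
      calc ∑ x ∈ P z, |∑ b, ∑ a, R b z * (M a x * K a x b z)|
          ≤ ∑ _x ∈ P z, (∑ b, |R b z|) * (((d : ℝ) + 1) * (CM * CK)) := Finset.sum_le_sum hpt
        _ = (P z).card * ((∑ b, |R b z|) * (((d : ℝ) + 1) * (CM * CK))) := by rw [Finset.sum_const, nsmul_eq_mul]
        _ ≤ (2 : ℝ) ^ (d + 1) * ((∑ b, |R b z|) * (((d : ℝ) + 1) * (CM * CK))) :=
            mul_le_mul_of_nonneg_right (hPcard z) (mul_nonneg hR0 (by positivity))
        _ = abs (∑ b, |R b z|) * (2 ^ (d + 1) * (((d : ℝ) + 1) * (CM * CK))) := by rw [abs_of_nonneg hR0]; ring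
  -- summability in `x` of the outer family (from the product summability)
  have hsz : ∀ a x, Summable fun z => ∑ b, R b z * K a x b z := by
    intro a x
    refine summable_of_finsupp (nearBox L (blk L x)) fun z hz => Finset.sum_eq_zero fun b _ => ?_
    by_cases h : off L x = 0 ∧ Near L (blk L x) z
    · exact absurd (mem_nearBox.2 h.2) hz
    · rw [hK0 a x b z h, mul_zero]
  calc ∑' z, ∑ b, R b z * ∑' x, ∑ a, M a x * K a x b z
      = ∑' z, ∑' x, ∑ b, ∑ a, R b z * (M a x * K a x b z) := by
        refine tsum_congr fun z => ?_
        rw [Summable.tsum_finsetSum (fun b _ => summable_sum fun a _ => hsx a b z)]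
        refine Finset.sum_congr rfl fun b _ => ?_
        rw [← tsum_mul_left]
        exact tsum_congr fun x => Finset.mul_sum _ _ _
    _ = ∑' x, ∑' z, ∑ b, ∑ a, R b z * (M a x * K a x b z) := hprod.tsum_comm.symm
    _ = ∑' x, ∑ a, M a x * ∑' z, ∑ b, R b z * K a x b z := by
        refine tsum_congr fun x => ?_
        have e : ∀ z, ∑ b, ∑ a, R b z * (M a x * K a x b z) = ∑ a, M a x * ∑ b, R b z * K a x b z := fun z => by
          rw [Finset.sum_comm]
          exact Finset.sum_congr rfl fun a _ => by rw [Finset.mul_sum]; exact Finset.sum_congr rfl fun b _ => by ring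
        rw [tsum_congr e, Summable.tsum_finsetSum (fun a _ => (hsz a x).mul_left _)]
        exact Finset.sum_congr rfl fun a _ => tsum_mul_left

/-- [folklore] **THE TABLE-SLOT BORDER CELL WITH THE FINE LEG OUTER, EXCHANGED AND FACTORISED** (fine leg `R` with summable slices, multiplier leg `M` bounded, gauge function
of bounded gradient; box root): `Σ'_z Σ_b R b z·Σ'_x Σ_a M a x·((ψ(x + ρ) − ψ z)·q(z,x)(inl b)(inr a))
= (L^{d+1})⁻¹·Σ'_x Σ_a M a x·[off L x = 0]·(ψ(x + ρ)·linAvgAt ρ R L a (blk L x) − linAvgAt ρ (ψ•R) L a (blk L x))`. -/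
theorem tsum_sum_leg_mul_tsum_sum_mul_rootWeight (hL : 1 ≤ L) (hr : r ∈ box (d + 1) L)
    {M : Form1 (d + 1) ℝ} {CM : ℝ} (hM : ∀ a x, |M a x| ≤ CM)
    {R : Form1 (d + 1) ℝ} (hRs : ∀ b, Summable fun z => R b z)
    {ψ : (Fin (d + 1) → ℤ) → ℝ} {G : ℝ} (hψ : ∀ κ x, |dz ψ κ x| ≤ G) :
    ∑' z, ∑ b, R b z * ∑' x, ∑ a, M a x * ((ψ (x + toSite r) - ψ z) * linSymAt (toSite r) L z x (Sum.inl b) (Sum.inr a))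
      = ∑' x, ∑ a, M a x * (if off L x = 0 then ((L : ℝ) ^ (d + 1))⁻¹ *
          (ψ (x + toSite r) * linAvgAt (toSite r) R L a (blk L x) - linAvgAt (toSite r) (fun b z => ψ z * R b z) L a (blk L x)) else 0) := by
  have hG : 0 ≤ G := (abs_nonneg _).trans (hψ 0 0)
  have hK0 : ∀ a x b z, ¬ (off L x = 0 ∧ Near L (blk L x) z) →
      (ψ (x + toSite r) - ψ z) * linSymAt (toSite r) L z x (Sum.inl b) (Sum.inr a) = 0 := fun a x b z h => by
    by_cases hq : linSymAt (toSite r) L z x (Sum.inl b) (Sum.inr a) = 0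
    · rw [hq, mul_zero]
    · exact absurd (off_eq_zero_and_near_of_linSymAt_ne_zero hr hq) h
  have hK : ∀ a x b z, off L x = 0 ∧ Near L (blk L x) z →
      |(ψ (x + toSite r) - ψ z) * linSymAt (toSite r) L z x (Sum.inl b) (Sum.inr a)| ≤ G * (((d : ℝ) + 1) * (2 * (L : ℝ))) * (ell (d + 1) L : ℝ) := by
    intro a x b z h
    rw [abs_mul]
    refine mul_le_mul ?_ (abs_linSymAt_inl_inr_le hL hr b z x a) (abs_nonneg _) (by positivity)
    have hx : x + toSite r = (L : ℤ) • blk L x + toSite r := by rw [← eq_smul_blk_of_off_eq_zero hL h.1]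
    refine (abs_sub_le_mul_l1_of_dz hψ z (x + toSite r)).trans (mul_le_mul_of_nonneg_left ?_ hG)
    rw [hx]
    exact l1_root_sub_le_of_mem hr (prox_of_near h.2)
  rw [tsum_sum_mul_tsum_sum_mul_comm hL hK0 hK hM hRs]
  refine tsum_congr fun x => Finset.sum_congr rfl fun a _ => ?_
  rw [tsum_sum_mul_rootWeight_mul_linSymAt hr R ψ (ψ (x + toSite r)) a x]

/-- [folklore] **THE FLUCTUATION-SLOT BORDER CELL WITH THE FINE LEG OUTER, EXCHANGED AND FACTORISED** (the shape of `ContactOneGaugeCellBorder.cellVflu_eq`'s right-hand side; fine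
leg `T` with summable slices, multiplier leg `M` bounded, gauge function of bounded gradient; box root):
`Σ'_u Σ_κ T κ u·Σ'_z Σ_μ M μ z·((ψ(u + e_κ) − ψ(z + ρ + L·e_μ))·q(u,z)(inl κ)(inr μ))
= Σ'_z Σ_μ M μ z·[off L z = 0]·(L^{d+1})⁻¹·(linAvgAt ρ (ψ⁺•T) L μ (blk L z) − ψ(z + ρ + L·e_μ)·linAvgAt ρ T L μ (blk L z))`. -/
theorem tsum_sum_leg_mul_tsum_sum_mul_tipWeight (hL : 1 ≤ L) (hr : r ∈ box (d + 1) L)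
    {M : Form1 (d + 1) ℝ} {CM : ℝ} (hM : ∀ μ z, |M μ z| ≤ CM)
    {T : Form1 (d + 1) ℝ} (hTs : ∀ κ, Summable fun u => T κ u)
    {ψ : (Fin (d + 1) → ℤ) → ℝ} {G : ℝ} (hψ : ∀ κ x, |dz ψ κ x| ≤ G) :
    ∑' u, ∑ κ, T κ u * ∑' z, ∑ μ, M μ z * ((ψ (u + unitVec κ) - ψ (z + toSite r + (L : ℤ) • unitVec μ)) * linSymAt (toSite r) L u z (Sum.inl κ) (Sum.inr μ))
      = ∑' z, ∑ μ, M μ z * (if off L z = 0 then ((L : ℝ) ^ (d + 1))⁻¹ *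
          (linAvgAt (toSite r) (fun κ u => ψ (u + unitVec κ) * T κ u) L μ (blk L z)
            - ψ (z + toSite r + (L : ℤ) • unitVec μ) * linAvgAt (toSite r) T L μ (blk L z)) else 0) := by
  have hG : 0 ≤ G := (abs_nonneg _).trans (hψ 0 0)
  have hK0 : ∀ μ z κ u, ¬ (off L z = 0 ∧ Near L (blk L z) u) →
      (ψ (u + unitVec κ) - ψ (z + toSite r + (L : ℤ) • unitVec μ)) * linSymAt (toSite r) L u z (Sum.inl κ) (Sum.inr μ) = 0 := fun μ z κ u h => by
    by_cases hq : linSymAt (toSite r) L u z (Sum.inl κ) (Sum.inr μ) = 0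
    · rw [hq, mul_zero]
    · exact absurd (off_eq_zero_and_near_of_linSymAt_ne_zero hr hq) h
  have hK : ∀ μ z κ u, off L z = 0 ∧ Near L (blk L z) u →
      |(ψ (u + unitVec κ) - ψ (z + toSite r + (L : ℤ) • unitVec μ)) * linSymAt (toSite r) L u z (Sum.inl κ) (Sum.inr μ)|
        ≤ G * (((d : ℝ) + 1) * (2 * (L : ℝ)) + 1) * (ell (d + 1) L : ℝ) := by
    intro μ z κ u h
    rw [abs_mul]
    refine mul_le_mul ?_ (abs_linSymAt_inl_inr_le hL hr κ u z μ) (abs_nonneg _) (by positivity)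
    have hz : z + toSite r + (L : ℤ) • unitVec μ = (L : ℤ) • blk L z + toSite r + (L : ℤ) • unitVec μ := by
      rw [← eq_smul_blk_of_off_eq_zero hL h.1]
    refine (abs_sub_le_mul_l1_of_dz hψ _ (u + unitVec κ)).trans (mul_le_mul_of_nonneg_left ?_ hG)
    calc l1 (u + unitVec κ - (z + toSite r + (L : ℤ) • unitVec μ))
        ≤ l1 (u + unitVec κ - u) + l1 (u - (z + toSite r + (L : ℤ) • unitVec μ)) := l1_sub_triangle _ _ _
      _ = 1 + l1 (u - (z + toSite r + (L : ℤ) • unitVec μ)) := by rw [add_sub_cancel_left, ← b6UnitVec_eq, l1_unitVec]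
      _ ≤ 1 + ((d : ℝ) + 1) * (2 * (L : ℝ)) := by
          rw [l1_sub_symm, hz]
          have := l1_farEnd_sub_le_of_mem hr (prox_of_near h.2) μ
          linarith
      _ = ((d : ℝ) + 1) * (2 * (L : ℝ)) + 1 := add_comm _ _
  rw [tsum_sum_mul_tsum_sum_mul_comm hL hK0 hK hM hTs]
  refine tsum_congr fun z => Finset.sum_congr rfl fun μ _ => ?_
  rw [tsum_sum_mul_tipWeight_mul_linSymAt hr T ψ (ψ (z + toSite r + (L : ℤ) • unitVec μ)) μ z]

end Exchange

/-! ## §3 The V-born kernel sockets re-read: every cell = (multiplier leg at the packed site) × (two-site commutator of the fine leg) -/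

section Sockets

variable {L : ℕ} {rr : Fin (d + 1) → ℕ}

/-- [folklore] **`contact_border_fm_eq_cells`, FACTORISED** (same hypotheses as `ContactBorderKernelCells.contact_border_fm_eq_cells`): channel `reslot inl inr V`,
`push₃ lᴱ M wᴱ S − push₃ lᴮ M wᴮ S (x′,z′,inl α,inl β) = Σ'_z Σ_μ M βz′ μ z·[off z = 0]·(L^{d+1})⁻¹·(linAvgAt ρ (λ_L⁺•wᴱ_{κ′u′}) − λ_L(z+ρ+L·e_μ)·linAvgAt ρ wᴱ_{κ′u′}) (μ, blk z)`
`+ Σ'_z Σ_μ M βz′ μ z·[off z = 0]·(L^{d+1})⁻¹·(λ_W(z+ρ)·linAvgAt ρ lᴮ_{αx′} − linAvgAt ρ (λ_W•lᴮ_{αx′})) (μ, blk z)`. -/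
theorem contact_border_fm_eq_factorised {lE lB M wE wB : Fin (d + 1) → (Fin (d + 1) → ℤ) → Fin (d + 1) → (Fin (d + 1) → ℤ) → ℝ}
    {lamL lamW : Fin (d + 1) → (Fin (d + 1) → ℤ) → (Fin (d + 1) → ℤ) → ℝ} {ClE ClB CwE CwB : ℝ}
    (hL : 1 ≤ L) (hrr : rr ∈ box (d + 1) L)
    (hlE : ∀ α x' κ x, |lE α x' κ x| ≤ ClE) (hlEs : ∀ α x' κ, Summable fun x => lE α x' κ x)
    (hlB : ∀ α x' κ x, |lB α x' κ x| ≤ ClB) (hlBs : ∀ α x' κ, Summable fun x => lB α x' κ x)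
    (hMs : ∀ β z' κ, Summable fun z => M β z' κ z)
    (hwE : ∀ κ' u' κ u, |wE κ' u' κ u| ≤ CwE) (hwB : ∀ κ' u' κ u, |wB κ' u' κ u| ≤ CwB)
    (hLg : lE - lB = fun μ y κ u => dz (lamL μ y) κ u) (hWg : wE - wB = fun μ y κ u => dz (lamW μ y) κ u)
    (κ' : Fin (d + 1)) (u' x' z' : Fin (d + 1) → ℤ) (α β : Fin (d + 1)) :
    push₃ lE M wE (reslot Sum.inl Sum.inr (vhSAt (toSite rr) d L rfl)) κ' u' x' z' (Sum.inl α) (Sum.inl β)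
        - push₃ lB M wB (reslot Sum.inl Sum.inr (vhSAt (toSite rr) d L rfl)) κ' u' x' z' (Sum.inl α) (Sum.inl β)
      = (∑' z, ∑ μ, M β z' μ z * (if off L z = 0 then ((L : ℝ) ^ (d + 1))⁻¹ *
            (linAvgAt (toSite rr) (fun κ u => lamL α x' (u + unitVec κ) * wE κ' u' κ u) L μ (blk L z)
              - lamL α x' (z + toSite rr + (L : ℤ) • unitVec μ) * linAvgAt (toSite rr) (wE κ' u') L μ (blk L z)) else 0))
        + (∑' z, ∑ μ, M β z' μ z * (if off L z = 0 then ((L : ℝ) ^ (d + 1))⁻¹ *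
            (lamW κ' u' (z + toSite rr) * linAvgAt (toSite rr) (lB α x') L μ (blk L z)
              - linAvgAt (toSite rr) (fun a x => lamW κ' u' x * lB α x' a x) L μ (blk L z)) else 0)) := by
  rw [contact_border_fm_eq_cells hL hrr hlE hlEs hlB hlBs hMs hwE hwB hLg hWg]
  simp only [tsum_sum_mul_tipWeight_mul_linSymAt hrr (wE κ' u') (lamL α x'),
    tsum_sum_mul_rootWeight_mul_linSymAt hrr (lB α x') (lamW κ' u')]

/-- [folklore] **`contact_border_mf_eq_cells`, FACTORISED** (same hypotheses as `ContactBorderKernelCells.contact_border_mf_eq_cells`; the gradient letter of `λ_W` is the table-leg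
bound through `wᴱ − wᴮ = dz λ_W`): channel `reslot inr inl V`, RIGHT cell pointwise, TABLE cell after the exchange of §2:
`push₃ M rᴱ wᴱ S − push₃ M rᴮ wᴮ S (x′,z′,inl α,inl β) = Σ'_x Σ_a M αx′ a x·[off x = 0]·(L^{d+1})⁻¹·(linAvgAt ρ (λ_R⁺•wᴱ_{κ′u′}) − λ_R(x+ρ+L·e_a)·linAvgAt ρ wᴱ_{κ′u′}) (a, blk x)`
`+ Σ'_x Σ_a M αx′ a x·[off x = 0]·(L^{d+1})⁻¹·(λ_W(x+ρ)·linAvgAt ρ rᴮ_{βz′} − linAvgAt ρ (λ_W•rᴮ_{βz′})) (a, blk x)`. -/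
theorem contact_border_mf_eq_factorised {M rE rB wE wB : Fin (d + 1) → (Fin (d + 1) → ℤ) → Fin (d + 1) → (Fin (d + 1) → ℤ) → ℝ}
    {lamR lamW : Fin (d + 1) → (Fin (d + 1) → ℤ) → (Fin (d + 1) → ℤ) → ℝ} {CM CrE CrB CwE CwB : ℝ}
    (hL : 1 ≤ L) (hrr : rr ∈ box (d + 1) L)
    (hM : ∀ α x' κ x, |M α x' κ x| ≤ CM) (hMs : ∀ α x' κ, Summable fun x => M α x' κ x)
    (hrE : ∀ β z' κ z, |rE β z' κ z| ≤ CrE) (hrEs : ∀ β z' κ, Summable fun z => rE β z' κ z)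
    (hrB : ∀ β z' κ z, |rB β z' κ z| ≤ CrB) (hrBs : ∀ β z' κ, Summable fun z => rB β z' κ z)
    (hwE : ∀ κ' u' κ u, |wE κ' u' κ u| ≤ CwE) (hwB : ∀ κ' u' κ u, |wB κ' u' κ u| ≤ CwB)
    (hRg : rE - rB = fun μ y κ u => dz (lamR μ y) κ u) (hWg : wE - wB = fun μ y κ u => dz (lamW μ y) κ u)
    (κ' : Fin (d + 1)) (u' x' z' : Fin (d + 1) → ℤ) (α β : Fin (d + 1)) :
    push₃ M rE wE (reslot Sum.inr Sum.inl (vhSAt (toSite rr) d L rfl)) κ' u' x' z' (Sum.inl α) (Sum.inl β)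
        - push₃ M rB wB (reslot Sum.inr Sum.inl (vhSAt (toSite rr) d L rfl)) κ' u' x' z' (Sum.inl α) (Sum.inl β)
      = (∑' x, ∑ a, M α x' a x * (if off L x = 0 then ((L : ℝ) ^ (d + 1))⁻¹ *
            (linAvgAt (toSite rr) (fun κ u => lamR β z' (u + unitVec κ) * wE κ' u' κ u) L a (blk L x)
              - lamR β z' (x + toSite rr + (L : ℤ) • unitVec a) * linAvgAt (toSite rr) (wE κ' u') L a (blk L x)) else 0))
        + (∑' x, ∑ a, M α x' a x * (if off L x = 0 then ((L : ℝ) ^ (d + 1))⁻¹ *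
            (lamW κ' u' (x + toSite rr) * linAvgAt (toSite rr) (rB β z') L a (blk L x)
              - linAvgAt (toSite rr) (fun b z => lamW κ' u' z * rB β z' b z) L a (blk L x)) else 0)) := by
  have hgW : ∀ κ u, |dz (lamW κ' u') κ u| ≤ CwE + CwB := fun κ u => by
    have e : dz (lamW κ' u') κ u = (wE - wB) κ' u' κ u := by rw [hWg]
    rw [e, Pi.sub_apply, Pi.sub_apply, Pi.sub_apply, Pi.sub_apply]
    exact (abs_sub _ _).trans (add_le_add (hwE κ' u' κ u) (hwB κ' u' κ u))
  rw [contact_border_mf_eq_cells hL hrr hM hMs hrE hrEs hrB hrBs hwE hwB hRg hWg,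
    tsum_sum_leg_mul_tsum_sum_mul_rootWeight hL hrr (M := M α x') (hM α x') (R := rB β z') (hrBs β z') hgW]
  simp only [tsum_sum_mul_tipWeight_mul_linSymAt hrr (wE κ' u') (lamR β z')]

end Sockets

end Summit.QuantumFields.BalabanUV.Beta.GAN24.ContactBorderCommutator

end
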